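/-
Copyright: the b2b-balaban cell (near-miss cell 7), T⁴-continuum fan-out, lineage t4-ne7b-p3 (node U5c LARGE-DEVIATION
member P3).  Released under the licence of the surrounding project.
-/
import Summits.QuantumFields.BalabanUV.T4Continuum.Support.SpaceTimeAssemblyM
import Summits.QuantumFields.BalabanUV.T4Continuum.Support.SpaceTimeRealisedDomainsFlow

/-!
# Space-time Peierls ∕ Cramér route for NE7b — THE SEPARATION-FREE JUNCTION: on the COUNT carrier the member-family
# readings hold with NO separation reading — the members of a contour are the live components it meets, each paying
# for the cells it occupies; and the same from the row owner's `RealisedDomainsR` along the run's own exponents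

Summits-side support leaf of the T⁴-continuum cell (rung (B)+1 on a FINITE torus only; NOT infinite volume, NOT the
mass gap, NOT the Clay statement; NOT a proof of the spine estimate NE7b).  Lineage `t4-ne7b-p3` (generation 3), node
U5c, skeleton `t4/skeletons/NE7b-t4-ne7b-p3.md` §15.  [folklore] assembly over this lineage's `SpaceTimeAssemblyM`,
`SpaceTimeRealisedT` (`RLin.toLinDataT`, `skelOK_linT`, `treeD_eqT`, `treeSteps_eqT`, `exists_root_eventT`),
`SpaceTimeRealisedDomains(Flow)` (`RLin.ofDomains`, `real_ofDomains`, `levelOf_extExp`), `SpaceTimeOccTorus`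
(`card_le_sum_occAt`, `contourCover`), `SpaceTimeOccupancy` (`sum_card_occAt_le_treeCells`), `SpaceTimeRealisedCells`
(`treeCells_le`), `SpaceTimeTagged`, and the COUNT swarm's `HistoryRealise` ∕ `HistoryRealiseCellsRun.RealisedDomainsR`
∕ `HistoryLevelsFlow` — all BY NAME; nothing printed is asserted; no `[cite:]` tag.

WHAT.
* §1 `RLin.members D τ 𝒦` (the lineages of `τ` occupying a cell of `𝒦`), `RLin.share` (the cells of `𝒦` a lineage
  occupies), `card_le_sum_share` (the members' shares cover the contour), `share_le_tree` (a share is bounded by the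
  member's tagged tree data).
* §2 **`RLin.lineageReadingsM`**: `LineageReadingsM D.toLinDataT.model (toGenT 0 ∘ D.P) C K Kc R g A Bad jlo nup …` from
  the flow side conditions, (i) nonnegativity, (ii′) rooting of bad terms before `jlo`, (iv‴) per lineage
  `Realises ∧ PendingAt K`, (v⁗) the MEMBER FACTORISATION `A τ ≤ e^{−Σ_{λ ∈ members τ 𝒦} (credits − lifeCost)(toGenT 0 (P λ))}
  · rest 𝒦 τ`, (vi) the remainder — and NO separation reading.
* §3 **`RLin.runReadingsFlowM_ofDomains`**: the binder `RunReadingsFlowM` of `exists_irThresholdM_relWeightBound` from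
  the row owner's `RealisedDomainsR` (field `real`) with `s K = extExp (expOf L (R K)) K` (the owner's `runProfile`, by
  `rfl`), the run's typed flow facts and readings (i) (ii′) (v⁗) (vi) ONLY.
HONEST RESIDUE OF THE CONTOUR ROUTE after this file: (a) the owner's H3 structure `RealisedDomainsR` (field `real`);
(c) the member factorisation (v⁗) + remainder (vi) — A3a ∕ A3e ∕ A3f, NOT PRINTED as statements; (d) the typed flow facts
(BetaPertH behind them); (e) (B) inside `LowEnvelope` ×2.  The separation reading (b) is GONE, as are `TypeNodup` and
`RenewAtReach`.

HONEST DEPENDENCY (cell, verbatim): continuum YM on T⁴ ⇐ BetaPertH ∧ nine spine estimates (0/9 proved); BetaPertH ⇐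
(D1) ∧ (D4) ∧ CAP+tail; G-an2-4 gates asym, D1 and NE2/3/4.  This file changes none of it.
-/

open Finset

namespace Summit.QuantumFields.BalabanUV.T4Continuum.SpaceTimePeierls

open Literature.MathematicalPhysics.QuantumFieldTheory.Balaban1983to89
open Literature.MathematicalPhysics.QuantumFieldTheory.Balaban1983to89.B13ScaleTransfer
open Literature.MathematicalPhysics.QuantumFieldTheory.Balaban1983to89.B16SProfile
open T4PersistenceDictionary T4BankedInduction T4PrintedShapeBanking
open T4TaggedShapeBanking (dictWT costT)
open Summit.QuantumFields.BalabanUV.T4Continuum.ZoneTorus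
open Summit.QuantumFields.BalabanUV.T4Continuum.ZoneSkeleton (gmap events_gmap)
open Summit.QuantumFields.BalabanUV.T4Continuum.HistoryZones (levelOf expOf expOf_succ_le dropCtl_expOf)
open Summit.QuantumFields.BalabanUV.T4Continuum.HistoryGen
open Summit.QuantumFields.BalabanUV.T4Continuum.HistoryAdmissible
open Summit.QuantumFields.BalabanUV.T4Continuum.HistoryRealise
open Summit.QuantumFields.BalabanUV.T4Continuum.HistoryRealiseCellsRun (RealisedDomainsR)
open Summit.QuantumFields.BalabanUV.T4Continuum.HistoryBankingLE (ConsistentTLE)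
open SpaceTimePeierlsLeaves

noncomputable section

open Classical

namespace RLin

variable {d n L Kx K : ℕ} {ℓ : ℕ → ℕ} {ι : Type*} {Λ : Type} [DecidableEq Λ] (D : RLin d n L Kx K ℓ ι Λ)

/-! ## §1 Members of a contour and their shares (lineage type `Λ : Type`, as the END's binder asks) -/

/-- **THE MEMBERS OF A CONTOUR**: the lineages of `τ` occupying (tagged occupancy) some cell of `𝒦`. [folklore] -/
def members (τ : ι) (𝒦 : Finset (STCellV d n L Kx K ℓ)) : Finset Λ :=
  (D.fam τ).filter fun lam => ∃ c ∈ 𝒦, D.toLinDataT.InLin lam c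

/-- **THE SHARE** of the lineage `λ` in `𝒦`: the cells of `𝒦` it occupies. [folklore] -/
def share (lam : Λ) (𝒦 : Finset (STCellV d n L Kx K ℓ)) : Finset (STCellV d n L Kx K ℓ) :=
  𝒦.filter fun c => D.toLinDataT.InLin lam c

/-- members are lineages of the term [folklore] -/
theorem members_subset (τ : ι) (𝒦 : Finset (STCellV d n L Kx K ℓ)) : D.members τ 𝒦 ⊆ D.fam τ := filter_subset _ _

/-- **THE MEMBERS' SHARES COVER THE CONTOUR**: `#𝒦 ≤ Σ_{λ ∈ members τ 𝒦} #share λ 𝒦` for a contour of `τ` (every cell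
of a contour is occupied by some lineage of the term). [folklore] -/
theorem card_le_sum_share {τ : ι} {𝒦 : Finset (STCellV d n L Kx K ℓ)} (h𝒦 : D.toLinDataT.model.IsContour τ 𝒦) :
    (𝒦.card : ℝ) ≤ ∑ lam ∈ D.members τ 𝒦, ((D.share lam 𝒦).card : ℝ) := by
  have hsub : 𝒦 ⊆ (D.members τ 𝒦).biUnion fun lam => D.share lam 𝒦 := by
    intro c hc
    obtain ⟨lam, hlam, hin⟩ := D.toLinDataT.mem_occT.1 (h𝒦.1 hc)
    rw [mem_biUnion]
    exact ⟨lam, mem_filter.2 ⟨hlam, c, hc, hin⟩, mem_filter.2 ⟨hc, hin⟩⟩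
  have h1 := card_le_card hsub
  have h2 := card_biUnion_le (s := D.members τ 𝒦) (t := fun lam => D.share lam 𝒦)
  exact_mod_cast h1.trans h2

/-- **A SHARE IS BOUNDED BY THE MEMBER's TAGGED TREE DATA**: under the drop control (`L ≥ 4`, `K ≤ m`) and `SkelOK` of
the tagged lineage, `#share λ 𝒦 ≤ 8·126^d · treeD tfat tstep dC (toGenT 0 (P λ)) (K+1) + 126^d · treeSteps tstep
(toGenT 0 (P λ)) (K+1)`. [folklore] -/
theorem share_le_tree {σ : ℕ → ℕ} {m : ℕ} (hL : 4 ≤ L) (hq : D.toLinDataT.q = ratio L σ) (hdrop : DropCtl σ m)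
    (hK : K ≤ m) {dC : ℝ} (hdC : 0 ≤ dC) {lam : Λ}
    (hok : SkelOK D.toLinDataT.q D.toLinDataT.step D.toLinDataT.piece fatTT dC (D.toLinDataT.G lam))
    (𝒦 : Finset (STCellV d n L Kx K ℓ)) :
    ((D.share lam 𝒦).card : ℝ) ≤ 8 * 126 ^ d * treeD tfat tstep dC (toGenT 0 (D.P lam)) (K + 1) +
      126 ^ d * treeSteps tstep (toGenT 0 (D.P lam)) (K + 1) := by
  have h1 := D.toLinDataT.card_le_sum_occAt lam (𝒦 := D.share lam 𝒦) fun c hc => (mem_filter.1 hc).2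
  have h2 := h1.trans (sum_card_occAt_le_treeCells _ _)
  have hok' := hok
  rw [hq] at hok' h2
  have h3 := treeCells_le hL hdrop hdC hok' (show K + 1 ≤ m + 1 by omega)
  have h4 := h2.trans h3
  rw [D.treeD_eqT, D.treeSteps_eqT] at h4
  exact h4

/-! ## §2 The member-family readings on the COUNT carrier — no separation -/

/-- **THE MEMBER-FAMILY READINGS ON THE COUNT CARRIER.**  Entropy fields, cover, the members' consistency ∕ WF ∕ reach,
the volume split and its bounds are PROVED; displayed: the flow side conditions, nonnegativity, the rooting of bad
terms before `jlo`, `Realises ∧ PendingAt` per lineage, the member factorisation and the remainder.  NO separation.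
[folklore] -/
theorem lineageReadingsM {C : T4PrintedShapeBanking.Consts} {Kc : ℕ} {R : ℕ → ℕ} {g : ℕ → ℝ} {A : ι → ℝ}
    {Bad : Finset ι} {jlo : ℕ} {nup c₃ : ℝ} {rest : Finset (STCellV d n L Kx K ℓ) → ι → ℝ}
    -- the flow
    (hn : 0 < n) (hL : 4 ≤ L) (hmono : ∀ u, ℓ u ≤ ℓ (u + 1)) (hjump : ∀ u, ℓ (u + 1) ≤ ℓ u + 2)
    (hqℓ : ∀ u, ratio L D.s u = L ^ (ℓ (u + 1) - ℓ u)) (hdrop : ∀ m, DropCtl D.s m) (hR : ∀ t, 1 ≤ R t)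
    (hn₁ : 13 ≤ C.n₁) (hKc : K ≤ Kc)
    -- (i) nonnegative weights; the bad class
    (hnonneg : ∀ τ ∈ D.T, 0 ≤ A τ) (hBad : Bad ⊆ D.T) (hjlo : jlo ≤ K)
    -- (ii′) the old structure
    (hold : ∀ τ ∈ Bad, ∃ lam ∈ D.fam τ, (D.P lam).rootStep ≤ jlo)
    -- (iv‴) realised and pending at the cutoff — nothing else
    (hreal : ∀ τ ∈ D.T, ∀ lam ∈ D.fam τ, Realises L D.s R (D.P lam) (D.Z lam) ∧
      PendingAt L D.s R (D.P lam).lastStep (D.Z lam) K)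
    -- (v⁗) member factorisation: the banked factors of ALL members of the contour are stripped
    (hfac : ∀ (𝒦 : Finset (STCellV d n L Kx K ℓ)), ∀ τ ∈ D.T, D.toLinDataT.model.IsContour τ 𝒦 →
        A τ ≤ Real.exp (-(∑ lam ∈ D.members τ 𝒦, (credits (credit C g ∘ Prod.snd) (toGenT 0 (D.P lam)) -
          lifeCost (dictWT Prod.snd R C.n₁) (costT Prod.snd C Kc R) (toGenT 0 (D.P lam))))) * rest 𝒦 τ)
    -- (vi) the remainder
    (hrest0 : ∀ (𝒦 : Finset (STCellV d n L Kx K ℓ)), ∀ τ ∈ D.T, 0 ≤ rest 𝒦 τ)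
    (hrest : ∀ (𝒦 : Finset (STCellV d n L Kx K ℓ)),
      ∑ τ ∈ D.toLinDataT.model.T.filter (fun τ => D.toLinDataT.model.IsContour τ 𝒦), rest 𝒦 τ ≤
        Real.exp c₃ ^ 𝒦.card * nup) :
    LineageReadingsM D.toLinDataT.model (fun lam => toGenT 0 (D.P lam)) C K Kc R g A Bad jlo nup
      (3 ^ d + L ^ (2 * d) + 1) ((((3 ^ d + L ^ (2 * d) + 1 : ℕ) : ℝ) + 1) ^ 2) (((n * L ^ (Kx - ℓ K)) ^ d : ℕ) : ℝ)
      (8 * 126 ^ d) (126 ^ d) ((127 : ℝ) ^ d + 3) c₃ := by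
  -- (iv‴) ⇒ the per-lineage facts on the tagged label
  have hlin : ∀ τ ∈ D.T, ∀ lam ∈ D.fam τ,
      ConsistentTLE Prod.snd C Kc R (toGenT 0 (D.P lam)) ∧ (toGenT 0 (D.P lam)).WF (dictWT Prod.snd R C.n₁) ∧
      K + 1 ≤ (toGenT 0 (D.P lam)).reach (dictWT Prod.snd R C.n₁) ∧
      SkelOK D.toLinDataT.q D.toLinDataT.step D.toLinDataT.piece fatTT ((127 : ℝ) ^ d + 3) (D.toLinDataT.G lam) := by
    intro τ hτ lam hlam
    obtain ⟨hRl, hPd⟩ := hreal τ hτ lam hlam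
    have hlast : (D.P lam).lastStep ≤ K := hPd.1
    exact ⟨consistentTLE_toGenT_of_realises hL hdrop hR C hn₁ hRl (hlast.trans hKc) 0,
      wf_toGenT_of_realises hL hdrop hR hn₁ hRl 0, lt_reach_toGenT_of_pendingAt hL hdrop hR hn₁ hRl hPd 0,
      D.skelOK_linT hL hdrop hRl⟩
  refine
    { deg := fun c => degree_stGraphV_le (by omega) hjump c
      animal := siteAnimalBound_sq (3 ^ d + L ^ (2 * d) + 1)
      anchors := ?_
      nonneg := hnonneg
      cover := D.toLinDataT.contourCover (fat := fatTT) (dC := (127 : ℝ) ^ d + 3) hn (by omega) hmono hqℓ hBad hjlo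
        fun τ hτ => ?_
      lineage := ?_ }
  · have h := card_anchorsV_le (d := d) (n := n) (L := L) (Kx := Kx) (K := K) (ℓ := ℓ) (by omega) (D.hℓK K le_rfl)
    exact_mod_cast h
  · -- (ii′) ⇒ (ii): the root event of a lineage rooted before `jlo`
    obtain ⟨lam, hlam, hroot⟩ := hold τ hτ
    obtain ⟨hRl, -⟩ := hreal τ (hBad hτ) lam hlam
    obtain ⟨e, he, hst, hne⟩ := exists_root_eventT 0 hRl
    refine ⟨lam, hlam, (hlin τ (hBad hτ) lam hlam).2.2.2, (lam, e), ?_, ?_, hne⟩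
    · rw [toLinDataT_G, events_gmap]
      exact mem_image_of_mem _ he
    · show tstep e ≤ jlo
      rw [hst]
      exact hroot
  · refine ⟨fun τ 𝒦 => D.members τ 𝒦, fun τ 𝒦 lam => (D.share lam 𝒦).card, rest, fun _ _ => K + 1,
      fun 𝒦 τ hτ h𝒦 => ⟨fun lam hlam => ?_, D.card_le_sum_share h𝒦, hfac 𝒦 τ hτ h𝒦⟩, hrest0, hrest⟩
    have hlam' : lam ∈ D.fam τ := D.members_subset τ 𝒦 hlam
    obtain ⟨hcons, hwf, hreach, hok⟩ := hlin τ hτ lam hlam'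
    exact ⟨hcons, hwf, hreach, D.share_le_tree hL rfl (hdrop K) le_rfl (by positivity) hok 𝒦⟩

end RLin

/-! ## §3 From the row owner's `RealisedDomainsR` along the run's own exponents — no separation -/

namespace RLin

variable {d n L K₀ : ℕ} {ι α π : Type*} [DecidableEq ι] [DecidableEq α]
  {s : ℕ → ℕ → ℕ} {R : ℕ → ℕ → ℕ} {T : ℕ → Finset ι} {ped : ℕ → ι → Pedigree α π}
  {cellP : ℕ → ι → π → Pt d × Finset (Pt d)} {liveC : ℕ → ι → Finset α} {Z : ℕ → ι → α → Finset (Pt d)}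

/-- **THE SEPARATION-FREE FLOW END's BINDER FROM THE OWNER's REALISED READING.**  For `H : RealisedDomainsR L s n K₀
R T ped cellP liveC Z` (field `real` only) with `s K = extExp (expOf L (R K)) K` (the owner's `runProfile L R K`, by
`rfl`), a run `K ≥ K₀` with cutoff `Kc ≥ K`, its typed flow facts, and readings (i) (ii′) (v⁗) (vi): the binder
`RunReadingsFlowM … K t` of `SpaceTimeAssemblyM.exists_irThresholdM_relWeightBound` — with lineage type `ι × α` (so
`ι α : Type`).  NO separation, NO `TypeNodup`, NO `RenewAtReach`. [folklore] -/
theorem runReadingsFlowM_ofDomains {ι α : Type} [DecidableEq ι] [DecidableEq α] {T : ℕ → Finset ι}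
    {ped : ℕ → ι → Pedigree α π} {cellP : ℕ → ι → π → Pt d × Finset (Pt d)} {liveC : ℕ → ι → Finset α}
    {Z : ℕ → ι → α → Finset (Pt d)}
    (H : RealisedDomainsR L s n K₀ R T ped cellP liveC Z) {K : ℕ} (hK : K₀ ≤ K)
    (hsK : s K = extExp (expOf L (R K)) K) {hN : 0 < n * L ^ K} {hℓK : ∀ u, u ≤ K → levelOf (s K) K u ≤ K}
    {C : T4PrintedShapeBanking.Consts} {r : ℕ} {γ β₀ x₀ β' : ℝ} {X : ℕ → ℝ → ι → ℝ} {Bad : ℕ → ℝ → Finset ι}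
    {xup : ℕ → ℝ → ℝ} {jstar : ℕ → ℕ} {c₃ : ℝ} {t : ℝ} {Kc : ℕ} {g : ℕ → ℝ}
    {rest : Finset (STCellV d n L K K (levelOf (s K) K)) → ι → ℝ}
    -- the typed flow facts of run `K`
    (hI : Step.InInterval γ Kc g) (hγ1 : γ ≤ 1) (hgmono : ∀ u, u < Kc → g u ≤ g (u + 1))
    (h27 : B14.FlowIneq27 g β' β₀ C.p₀ Kc) (h27r : B14.FlowIneq27 g β' β₀ r Kc)
    (h29 : B14FlowStep.FlowIneq29 (R K) g L β' β₀ Kc) (hRj : ∀ u, u ≤ Kc → B14.IsRj L r (g u) (R K u))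
    (hΘ : ∀ m u, m < u → u ≤ Kc → (1 + (g u) ^ 2 * β' * ((u : ℝ) - m)) ^ β₀ ≤ (L : ℝ) ^ (max (u - m) 2 / 2))
    (hx1 : ∀ u, u ≤ Kc → 1 ≤ Real.log ((g u) ^ 2)⁻¹) (hxK : x₀ ≤ Real.log ((g Kc) ^ 2)⁻¹)
    -- side conditions and readings
    (hn : 0 < n) (hL : 4 ≤ L) (hR : ∀ t, 1 ≤ R K t) (hn₁ : 13 ≤ C.n₁) (hKc : K ≤ Kc)
    (hnonneg : ∀ τ ∈ T K, 0 ≤ X K t τ) (hBad : Bad K t ⊆ T K) (hjlo : jstar K ≤ K)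
    (hold : ∀ τ ∈ Bad K t, ∃ c ∈ liveC K τ, ((ped K τ).toPGen (cellP K τ) c).rootStep ≤ jstar K)
    (hfac : ∀ (𝒦 : Finset (STCellV d n L K K (levelOf (s K) K))), ∀ τ ∈ T K,
      (ofDomains s T ped cellP liveC Z K hN hℓK).toLinDataT.model.IsContour τ 𝒦 →
        X K t τ ≤ Real.exp (-(∑ lam ∈ (ofDomains s T ped cellP liveC Z K hN hℓK).members τ 𝒦,
          (credits (credit C g ∘ Prod.snd) (toGenT 0 ((ped K lam.1).toPGen (cellP K lam.1) lam.2)) -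
            lifeCost (dictWT Prod.snd (R K) C.n₁) (costT Prod.snd C Kc (R K))
              (toGenT 0 ((ped K lam.1).toPGen (cellP K lam.1) lam.2))))) * rest 𝒦 τ)
    (hrest0 : ∀ (𝒦 : Finset (STCellV d n L K K (levelOf (s K) K))), ∀ τ ∈ T K, 0 ≤ rest 𝒦 τ)
    (hrest : ∀ (𝒦 : Finset (STCellV d n L K K (levelOf (s K) K))),
      ∑ τ ∈ (ofDomains s T ped cellP liveC Z K hN hℓK).toLinDataT.model.T.filter
          (fun τ => (ofDomains s T ped cellP liveC Z K hN hℓK).toLinDataT.model.IsContour τ 𝒦),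
          rest 𝒦 τ ≤ Real.exp c₃ ^ 𝒦.card * xup K t) :
    RunReadingsFlowM C L r β₀ x₀ T X Bad xup jstar ((((3 ^ d + L ^ (2 * d) + 1 : ℕ) : ℝ) + 1) ^ 2)
      (((n * L ^ (K - levelOf (s K) K K)) ^ d : ℕ) : ℝ) (8 * 126 ^ d) (126 ^ d) ((127 : ℝ) ^ d + 3) c₃ K t := by
  set D := ofDomains s T ped cellP liveC Z K hN hℓK with hD
  have hL2 : 2 ≤ L := by omega
  have hsKc : ∀ u, u < Kc → expOf L (R K) (u + 1) ≤ expOf L (R K) u :=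
    expOf_succ_le hL2 hRj (fun u hu => (hI u hu).1) (fun u hu => (hI u hu).2.trans hγ1) hgmono
  have hdropKc : DropCtl (expOf L (R K)) Kc := dropCtl_expOf hL2 hI hγ1 hRj h27r hΘ
  have hs : ∀ u, u < K → expOf L (R K) (u + 1) ≤ expOf L (R K) u := fun u hu => hsKc u (lt_of_lt_of_le hu hKc)
  have hdropK : DropCtl (expOf L (R K)) K := fun i k hik hk => hdropKc i k hik (hk.trans hKc)
  have hdrop' : ∀ m, DropCtl D.s m := fun m => by
    show DropCtl (s K) m
    rw [hsK]; exact dropCtl_extExp hdropK m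
  have hmono : ∀ u, levelOf (s K) K u ≤ levelOf (s K) K (u + 1) := fun u => by
    rw [hsK, levelOf_extExp, levelOf_extExp]
    exact levelOf_mono' hs hdropK u
  have hjump : ∀ u, levelOf (s K) K (u + 1) ≤ levelOf (s K) K u + 2 := fun u => by
    rw [hsK, levelOf_extExp, levelOf_extExp]
    exact levelOf_jump hs hdropK u
  have hqℓ : ∀ u, ratio L D.s u = L ^ (levelOf (s K) K (u + 1) - levelOf (s K) K u) := by
    intro u
    show ratio L (s K) u = _
    rw [hsK, levelOf_extExp, levelOf_extExp]
    exact ratio_extExp_eq hs hdropK L u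
  have hreadings := D.lineageReadingsM (C := C) (Kc := Kc) (R := R K) (g := g) (A := X K t) (Bad := Bad K t)
    (jlo := jstar K) (nup := xup K t) (c₃ := c₃) (rest := rest) hn hL hmono hjump hqℓ hdrop' hR hn₁ hKc hnonneg hBad
    hjlo (fun τ hτ => ?_) (real_ofDomains H hK) (fun 𝒦 τ hτ h𝒦 => hfac 𝒦 τ hτ h𝒦) hrest0 hrest
  · exact ⟨STCellV d n L K K (levelOf (s K) K), inferInstance, inferInstance, D.toLinDataT.model, inferInstance, ι × α,
      fun lam => toGenT 0 (D.P lam), 3 ^ d + L ^ (2 * d) + 1, Kc, R K, g, β', rfl, h27, h29, hRj, hx1, hxK, hreadings⟩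
  · obtain ⟨c, hc, hroot⟩ := hold τ hτ
    exact ⟨(τ, c), mem_image_of_mem _ hc, hroot⟩

end RLin

end

end Summit.QuantumFields.BalabanUV.T4Continuum.SpaceTimePeierls
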